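import Summits.QuantumFields.YangMills.Theorems.BalabanUVNodesN15ColouredLiveBackgroundMatrixDecay
import Summits.QuantumFields.YangMills.Theorems.BalabanUVNodesN15LiveGluedPropagatorIncrementDefect
import Summits.QuantumFields.YangMills.Theorems.BalabanUVNodesN15TwoSpacingGluingAveragingDefect
import HarnessLib

/-!
# N15 = NE2 — Σ-col (J-b): THE η-DIFFERENCE OF THE LIVE BACKGROUND MATRIX, `|Z′(A) − Z(A)|_{pq} ≤ K·((L^k)^{−1/16} + κ_e r_A L^{−k})·e^{−δ·cdist}`, AND THE THREE LETTERS TOGETHER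
# (dag-n15-a g29, programme Σ-col, FILE (J-b); node N15 = NE2; `--kind proof --supports stmt-QuantumFields-27366 --as helper`, count-neutral, theorems only, 0 def)

WHY.  Σ-col (H) `exDress_deltaCol_letters` — the letters of the exact (1.103) dressing on dag-n15-c's COLOURED unit-bond carrier — wants THREE letters on its middle factor: decay at each
spacing ((i),(ii); FILE (J-a) `exists_abs_zc_le` for the LIVE background matrix `Z(A) = unitBondMatC((Q⊗1)(X(A) − G⊗1)(Q*⊗1))` of dag-n15-c's glued covariant propagator) and the
η-DIFFERENCE (iii) between the two spacings ON THE SAME coloured unit bonds.  This file supplies (iii), and packages (i)(ii)(iii) with common constants (§3) — the complete input of (H) for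
the U-live SITE layer on dag-n15-c's carrier (Σ-col (J-c), the sequel).

HOW (§1 + §2).  The telescoping `Q′T′Q′* − QTQ* = Q′∘(T′∘(Q′* − PQ*)) + Q′∘(𝔇(T′,T)∘Q*) + (Q′P − Q)∘(T∘Q*)` (`P` = King's pairing ⊗ 1_ι, `𝔇(T′,T) = T′P − PT`); the stencil comparison
`Q′* − PQ* = O(L^{−k})` (dag-n15-a part 45 `hasMaj_qvAdjRe_sub_pull_comp`) and the line-difference letter `Q′P − Q = O(L^{−k})` ON ROUGH INPUTS (dag-n15-c FILE 99 `hasMaj_lineDiff_comp` →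
`hasMaj_qvRe_pull_sub_comp_of_line`), both lifted to the colour by N-II `hasMaj_tensorId`; the increment letters `T, T′ = O(κ_e r_A)` (FILE (I-b)) and the η-defect of the increment
`𝔇(T′,T) = O((L^k)^{−1/16} + κ_e r_A L^{−k})` (FILE (I-c)); six compositions with rates ([B11] `hasMaj_comp_exp`, Lemma 2.1's row sum on the unit torus, margins a half then a quarter of the
common base rate); FILE (J-a) §2 reads the block majorant as a coloured entry letter.

WHAT.  §1 `sandwich_telescope` (the algebra), `tensorId_pull` (`(pull π) ⊗ 1_ι = pull (π × id)`); §2 ★★★ `exists_abs_zc_sub_le` (letter (iii), both increments in FILE 133's regime);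
§3 ★★★ `exists_zc_letters` ((i) ∧ (ii) ∧ (iii) with ONE `δ, w₀, R₀, K`).
Honest label: MODEL objects as FILE 130∕133 (NOT [B9] Thm 3.1 as printed); operator-side input of the U-live site∕unit layers only; no layer of NE2 proved here; no count.
[cite: Balaban1984PropagatorsI, (1.18) p.20, (1.102)–(1.103) p.34; Balaban1984PropagatorsII, (2.52)–(2.56) pp.232–233, Lemma 2.1 (2.61) p.234; Balaban1985BackgroundPropagators, Thm 3.1 (3.42) p.397 (η-rate: shape), (3.62)–(3.65) pp.402–403; King1986, p.664 (the pairing), Prop. 3.9 (3.73) p.665 (η-rate shape)]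
-/

open scoped BigOperators Matrix Matrix.Norms.Frobenius

namespace Summit.QuantumFields.YangMills.BalabanUVNodes.N15.GluedZeroField

open Literature.MathematicalPhysics.QuantumFieldTheory.Balaban1983to89
open Literature.MathematicalPhysics.QuantumFieldTheory.King1986 (exp_decay_mono)
open Literature.MathematicalPhysics.QuantumFieldTheory.Balaban1983to89.B5Prop11Plancherel (Tor fine)
open Literature.MathematicalPhysics.QuantumFieldTheory.Balaban1983to89.B11SectG (BlockNorm HasMaj RowSum hasMaj_comp_exp)
open Literature.MathematicalPhysics.QuantumFieldTheory.Balaban1983to89.B9Eq3130MatrixLetters (hasMaj_id_ofBlocks)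
open Literature.MathematicalPhysics.QuantumFieldTheory.Balaban1983to89.B6UnitTorusCarrier (unitTorusGeo unitTorusGeo_dist unitTorusGeo_dist_nonneg unitTorusGeo_dist_self triangle254_unitTorusGeo rowSum_unitTorusGeo)
open Literature.MathematicalPhysics.QuantumFieldTheory.Balaban1983to89.B6Lemma24Torus (pbox)
open Literature.MathematicalPhysics.QuantumFieldTheory.Balaban1983to89.T4EtaRateDefect (idef)
open Literature.MathematicalPhysics.QuantumFieldTheory.Balaban1983to89.T4EtaRateCoeffDefect (pull)
open Literature.MathematicalPhysics.QuantumFieldTheory.King1986.Torus (blockOf tdistT)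
open Literature.Barriers.QuantumFields (traceForm)
open Summit.QuantumFields.YangMills.BalabanUVNodes.N15.BackgroundLayer (gavgM tensorId_sub tensorId_comp_tensorId)
open Summit.QuantumFields.YangMills.BalabanUVNodes.N15.BackgroundModel (kappa_ofBlocks)
open Summit.QuantumFields.YangMills.BalabanUVNodes.N15.SiteLayer (hasMaj_exp_mono)
open Summit.QuantumFields.YangMills.BalabanUVNodes.N15.VectorPiece (bshiftEquiv kingPrV blkFine tensorId tensorId_apply hasMaj_tensorId blkFine_comp_kingPrV)
open Summit.QuantumFields.YangMills.BalabanUVNodes.N15.MatrixSpecies (basisConst basisConst_nonneg liftBlk liftMap)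
open Summit.QuantumFields.YangMills.BalabanUVNodes.N15.TwoGrid (gOp qvRe qvAdjRe symbOp sD sA hasMaj_qvAdjRe_sub_pull_comp)
open Summit.QuantumFields.YangMills.BalabanUVNodes.N15.UnitLayerBgCol (unitBondMatC unitBondMatC_sub cdist cdist_nonneg)
open Summit.QuantumFields.YangMills.BalabanUVNodes.N15.Gluing (cvM CvX CvX' cvBlk CvNorm cvNL cvNL' cvGlued cvGlued' hasMaj_lineDiff_comp hasMaj_qvRe_pull_sub_comp_of_line)

variable {d : ℕ}

/-! ## §1 Algebra: the sandwich telescopes; the pull-back of King's pairing tensored with the colour -/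

section Algebra

variable {V₂ V₃ W : Type} [AddCommGroup V₂] [Module ℝ V₂] [AddCommGroup V₃] [Module ℝ V₃] [AddCommGroup W] [Module ℝ W]

/-- **THE SANDWICH TELESCOPES**: with `𝔇(T′,T) = T′P − PT`,
`Q′T′A′ − QTA = Q′∘(T′∘(A′ − PA)) + Q′∘(𝔇(T′,T)∘A) + (Q′P − Q)∘(TA)`. [folklore] -/
theorem sandwich_telescope (Qf : V₃ →ₗ[ℝ] W) (Qc : V₂ →ₗ[ℝ] W) (T' : V₃ →ₗ[ℝ] V₃) (T : V₂ →ₗ[ℝ] V₂) (Af : W →ₗ[ℝ] V₃) (Ac : W →ₗ[ℝ] V₂) (P : V₂ →ₗ[ℝ] V₃) :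
    Qf ∘ₗ T' ∘ₗ Af - Qc ∘ₗ T ∘ₗ Ac = Qf ∘ₗ (T' ∘ₗ (Af - P ∘ₗ Ac)) + (Qf ∘ₗ (idef P P T' T ∘ₗ Ac) + (Qf ∘ₗ P - Qc) ∘ₗ (T ∘ₗ Ac)) := by
  simp only [idef, LinearMap.comp_sub, LinearMap.sub_comp, LinearMap.comp_assoc]
  abel

/-- `(pull π) ⊗ 1_ι = pull (π × id_ι)`: King's pairing of the scalar bond fields tensored with the colour IS the pairing of the coloured bond fields. [folklore] -/
theorem tensorId_pull {X X' : Type} (ι : Type) (π : X' → X) : tensorId ι (pull π) = pull (liftMap π ι) :=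
  LinearMap.ext fun _ => funext fun _ => rfl

/-- Three amplitudes against one: `A₁ + A₂ + A₃ ≤ B`, `E ≥ 0` ⟹ `A₁E + (A₂E + A₃E) ≤ BE`. [folklore] -/
theorem three_mul_le {A₁ A₂ A₃ B E : ℝ} (hE : 0 ≤ E) (h : A₁ + A₂ + A₃ ≤ B) : A₁ * E + (A₂ * E + A₃ * E) ≤ B * E := by
  nlinarith [mul_le_mul_of_nonneg_right h hE]

end Algebra

/-! ## §2 The η-difference of the live background matrix -/

section Rate

variable {L : ℕ} [NeZero L]

set_option maxHeartbeats 800000 in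
/-- ★★★ **`|Z′(A)_{pq} − Z(A)_{pq}| ≤ K·((L^k)^{−1/16} + κ_e·r_A·L^{−k})·e^{−δ·cdist(p,q)}`** — letter (iii) of Σ-col (H) `exDress_deltaCol_letters` for the LIVE background matrices
`Z(A) = unitBondMatC((Q⊗1)(X(A) − G⊗1)(Q*⊗1))` (spacing `L^{−k}`) and `Z′(A) = unitBondMatC((Q′⊗1)(X′(A) − G′⊗1)(Q′*⊗1))` (spacing `L^{−(r+k)}`) of dag-n15-c's glued covariant propagators on
the SAME coloured unit bonds of the cover, in FILE 133's regime (odd `L ≥ 7`, `a > 0`, `k ≥ 1`, `L^m ≥ w₀`; skew-Hermitian fine potential `A′` in the C² window at scale `r_A`,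
`2(2+d)(5+2d)r_A ≤ 1`, scale `≤ R₀`); `K, δ, w₀, R₀` from `d, L, a, ι` only.  Proof: §1's telescoping; part 45's stencil comparison `Q′* − PQ* = O(L^{−k})` and FILE 99's line-difference
letter `Q′P − Q = O(L^{−k})` on rough inputs, ⊗ 1_ι (N-II `hasMaj_tensorId`); FILE (I-b)'s increment letters; FILE (I-c)'s η-defect of the increment; six [B11] compositions with rates;
FILE (J-a) §2's entry letter. [cite: Balaban1984PropagatorsI, (1.18) p.20, (1.102)–(1.103) p.34; Balaban1984PropagatorsII, (2.52)–(2.56) pp.232–233, Lemma 2.1 (2.61) p.234; Balaban1985BackgroundPropagators, Thm 3.1 (3.42) p.397 (η-rate: shape), (3.62)–(3.65) pp.402–403; King1986, p.664, Prop. 3.9 (3.73) p.665 (η-rate shape)] -/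
theorem exists_abs_zc_sub_le (hL : Odd L ∧ 1 < L) (hL7 : 7 ≤ L) {a : ℝ} (ha : 0 < a) (ι : Type) [Fintype ι] [DecidableEq ι] [Nonempty ι] :
    ∃ δ w₀ R₀ K : ℝ, 0 < δ ∧ 0 < R₀ ∧ 0 < K ∧
      ∀ (mv kk r : ℕ), 1 ≤ kk → w₀ ≤ ((L ^ mv : ℕ) : ℝ) →
      ∀ {mm : Type} [Fintype mm] [DecidableEq mm] (e : Matrix mm mm ℂ ≃L[ℝ] (ι → ℝ)), (∀ A B : Matrix mm mm ℂ, traceForm A B = e A ⬝ᵥ e B) →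
      ∀ (A' : Fin (d + 1) → CvX' d L mv kk r hL → Matrix mm mm ℂ), (∀ μ x', (A' μ x')ᴴ = -A' μ x') →
      ∀ (rA : ℝ), 0 ≤ rA → (∀ μ x', ‖A' μ x'‖ ≤ rA) →
        (∀ μ κ x', ‖A' μ (bshiftEquiv (cvM d L mv kk hL) (L ^ r * L ^ kk) κ x') - A' μ x'‖ ≤ rA * ((((L ^ r * L ^ kk : ℕ) : ℝ))⁻¹)) →
        (∀ μ κ x', ‖(A' μ (bshiftEquiv (cvM d L mv kk hL) (L ^ r * L ^ kk) κ x') - A' μ x') -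
            (A' μ (bshiftEquiv (cvM d L mv kk hL) (L ^ r * L ^ kk) κ ((bshiftEquiv (cvM d L mv kk hL) (L ^ r * L ^ kk) μ).symm x')) -
              A' μ ((bshiftEquiv (cvM d L mv kk hL) (L ^ r * L ^ kk) μ).symm x'))‖ ≤ rA * ((((L ^ r * L ^ kk : ℕ) : ℝ))⁻¹) * ((((L ^ r * L ^ kk : ℕ) : ℝ))⁻¹)) →
        2 * ((1 + Fintype.card (Fin (d + 1))) * ((3 + 2 * ((d : ℝ) + 1)) * rA)) ≤ 1 →
        (14 * Real.exp 1 * (1 + Fintype.card (Fin (d + 1))) * basisConst e * ((1 + Fintype.card (Fin (d + 1))) * ((3 + 2 * ((d : ℝ) + 1)) * rA))) * (1 + Fintype.card (Fin (d + 1) ⊕ Fin (d + 1))) ≤ R₀ →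
        ∀ p q, |unitBondMatC (cvM d L mv kk hL) ι
            (tensorId ι (qvRe (cvM d L mv kk hL) (L ^ r * L ^ kk)) ∘ₗ
              (cvGlued' d L mv kk r hL a ((((L ^ r * L ^ kk : ℕ) : ℝ))⁻¹) ι e (fun _ _ => (1 : Matrix mm mm ℂ)) (fun μ x' => NormedSpace.exp (((((L ^ r * L ^ kk : ℕ) : ℝ))⁻¹) • A' μ x'))
                  (cvNL' d L mv kk r hL a ι) (fun _ => 0) -
                tensorId ι (gOp (cvM d L mv kk hL) (L ^ r * L ^ kk) a)) ∘ₗ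
              tensorId ι (qvAdjRe (cvM d L mv kk hL) (L ^ r * L ^ kk))) p q -
          unitBondMatC (cvM d L mv kk hL) ι
            (tensorId ι (qvRe (cvM d L mv kk hL) (L ^ kk)) ∘ₗ
              (cvGlued d L mv kk hL a ((((L ^ kk : ℕ) : ℝ))⁻¹) ι e (fun _ _ => (1 : Matrix mm mm ℂ))
                  (fun μ x => NormedSpace.exp (((((L ^ kk : ℕ) : ℝ))⁻¹) • gavgM (Matrix mm mm ℂ) (Fin (d + 1)) (kingPrV L kk r (cvM d L mv kk hL)) A' μ x)) (cvNL d L mv kk hL a ι) (fun _ => 0) -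
                tensorId ι (gOp (cvM d L mv kk hL) (L ^ kk) a)) ∘ₗ
              tensorId ι (qvAdjRe (cvM d L mv kk hL) (L ^ kk))) p q|
          ≤ K * ((((L ^ kk : ℕ) : ℝ)) ^ (-(1 / 16 : ℝ)) + basisConst e * rA * ((((L ^ kk : ℕ) : ℝ))⁻¹)) * Real.exp (-(δ * cdist (cvM d L mv kk hL) ι p q)) := by
  have hLpos : 0 < L := Nat.pos_of_ne_zero (NeZero.ne L)
  -- FILE (I-b): the increment letters (rate δ₁); FILE (I-c): the η-defect of the increment (rate δ₂)
  obtain ⟨δ₁, w₁, R₁, K₁, hδ₁, hR₁, hK₁, H₁⟩ := exists_hasMaj_cvGlued_sub_tensorId_gOp (d := d) hL hL7 ha ι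
  obtain ⟨δ₂, w₂, R₂, K₂, hδ₂, hR₂, hK₂, H₂⟩ := exists_hasMaj_idef_cvGlued_sub_tensorId_gOp (d := d) hL hL7 ha ι
  -- the common base rate `ρ₀`; compositions at margins `ρ₀∕2`, then `ρ₀∕4`
  obtain ⟨ρ₀, hρ₀def⟩ : ∃ ρ₀ : ℝ, ρ₀ = min δ₁ δ₂ := ⟨_, rfl⟩
  have hρ₀ : 0 < ρ₀ := by rw [hρ₀def]; exact lt_min hδ₁ hδ₂
  have hρ₀₁ : ρ₀ ≤ δ₁ := by rw [hρ₀def]; exact min_le_left _ _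
  have hρ₀₂ : ρ₀ ≤ δ₂ := by rw [hρ₀def]; exact min_le_right _ _
  have hσ₂ : 0 < ρ₀ / 2 := by positivity
  have hσ₄ : 0 < ρ₀ / 4 := by positivity
  set c₂ : ℝ := B4Sect5Proof.latticeConst (d + 1) (ρ₀ / 2) + 1 with hc₂
  set c₄ : ℝ := B4Sect5Proof.latticeConst (d + 1) (ρ₀ / 4) + 1 with hc₄
  have hc₂0 : 0 < c₂ := by have := B4Sect5Proof.latticeConst_nonneg (d + 1) hσ₂.le; rw [hc₂]; linarith
  have hc₄0 : 0 < c₄ := by have := B4Sect5Proof.latticeConst_nonneg (d + 1) hσ₄.le; rw [hc₄]; linarith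
  refine ⟨ρ₀ / 4, max w₁ w₂, min R₁ R₂, c₂ * c₄ * Real.exp (ρ₀ / 2) * Real.exp ρ₀ * (4 * K₁ + K₂), hσ₄, lt_min hR₁ hR₂, by positivity, fun mv kk r hk hw₀ => ?_⟩
  intro mm _ _ e he A' hA' rA hrA h1 h2 h3 hr2 hRle
  obtain ⟨hT, hT'⟩ := H₁ mv kk r hk ((le_max_left _ _).trans hw₀) e he A' hA' rA hrA h1 h2 h3 hr2 (hRle.trans (min_le_left _ _))
  have hD := H₂ mv kk r hk ((le_max_right _ _).trans hw₀) e he A' hA' rA hrA h1 h2 h3 hr2 (hRle.trans (min_le_right _ _))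
  -- (I-c)'s codomain blocks `cvBlk ∘ kingPrV` ARE the fine King blocks (King's `blockOf_over`)
  have hbk : cvBlk d L mv kk hL ∘ kingPrV L kk r (cvM d L mv kk hL) = fun i' : CvX' d L mv kk r hL => blockOf (L ^ r * L ^ kk) (cvM d L mv kk hL) i'.1 :=
    blkFine_comp_kingPrV (M := cvM d L mv kk hL) L kk r
  rw [hbk] at hD
  set M := cvM d L mv kk hL with hM
  have hκ0 : 0 ≤ basisConst e := basisConst_nonneg e
  have hkpos : (0 : ℝ) < ((L ^ kk : ℕ) : ℝ) := Nat.cast_pos.mpr (pow_pos hLpos kk)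
  have hθ0 : 0 ≤ (((L ^ kk : ℕ) : ℝ)) ^ (-(1 / 16 : ℝ)) := Real.rpow_nonneg hkpos.le _
  have hη0 : 0 ≤ ((((L ^ kk : ℕ) : ℝ))⁻¹) := inv_nonneg.mpr hkpos.le
  have hA0 : 0 ≤ K₁ * basisConst e * rA := by positivity
  have hB0 : 0 ≤ K₂ * ((((L ^ kk : ℕ) : ℝ)) ^ (-(1 / 16 : ℝ)) + basisConst e * rA * ((((L ^ kk : ℕ) : ℝ))⁻¹)) := by positivity
  have htri := triangle254_unitTorusGeo L kk M
  have hd := fun y y' => unitTorusGeo_dist_nonneg L kk M y y'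
  have hrow₂ : RowSum (unitTorusGeo L kk M) (ρ₀ / 2) c₂ := fun y => (rowSum_unitTorusGeo L kk M hσ₂ y).trans (by rw [hc₂]; linarith)
  have hrow₄ : RowSum (unitTorusGeo L kk M) (ρ₀ / 4) c₄ := fun y => (rowSum_unitTorusGeo L kk M hσ₄ y).trans (by rw [hc₄]; linarith)
  -- the letters at the common base rate
  have hT₀ := hasMaj_exp_mono hd hA0 hρ₀₁ hT
  have hT'₀ := hasMaj_exp_mono hd hA0 hρ₀₁ hT'
  have hD₀ := hasMaj_exp_mono hd hB0 hρ₀₂ hD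
  -- the coloured `Q′` (rate `ρ₀∕2`) and `Q*` (rate `ρ₀`) letters (FILE (J-a) §1)
  have hQf := hasMaj_tensorId_qvRe (L := L) M kk (L ^ r * L ^ kk) ι hσ₂.le
  have hAc := hasMaj_tensorId_qvAdjRe (L := L) M kk (L ^ kk) ι hρ₀.le
  -- the stencil comparison `Q′* − PQ*` ⊗ 1_ι (part 45, at `S = id`)
  have h45 := hasMaj_qvAdjRe_sub_pull_comp M kk r (B := 1) zero_le_one hρ₀.le
    (hasMaj_id_ofBlocks (g := unitTorusGeo L kk M) (fun b : Tor M × Fin (d + 1) => b.1) (unitTorusGeo_dist_self L kk M) ρ₀)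
  rw [LinearMap.comp_id] at h45
  have hb := hasMaj_tensorId ι (fun y y' => by positivity) h45
  rw [tensorId_sub, ← tensorId_comp_tensorId, tensorId_pull] at hb
  -- the line-difference letter `Q′P − Q` ON ROUGH INPUTS ⊗ 1_ι (FILE 99, at `S = id`, rate `ρ₀∕2`)
  have h0 := hasMaj_id_ofBlocks (g := unitTorusGeo L kk M) (blkFine L kk M) (unitTorusGeo_dist_self (L := L) (k := kk) (M := M)) (ρ₀ / 2)
  have hline : ∀ κ : Fin (d + 1), HasMaj (BlockNorm.ofBlocks (unitTorusGeo L kk M) (blkFine L kk M)) (BlockNorm.ofBlocks (unitTorusGeo L kk M) (blkFine L kk M))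
      ((((L ^ kk : ℕ) : ℝ)⁻¹ • symbOp M (L ^ kk) (sD M (L ^ kk) κ ((L ^ kk : ℕ) : ℝ))) ∘ₗ (symbOp M (L ^ kk) (sA M (L ^ kk) κ (L ^ kk)) ∘ₗ LinearMap.id))
      (fun y y' => 2 * Real.exp (ρ₀ / 2) / ((L ^ kk : ℕ) : ℝ) * 1 * Real.exp (-(ρ₀ / 2 * tdistT M y y'))) := fun κ =>
    hasMaj_lineDiff_comp M kk (L ^ kk) zero_le_one hσ₂.le κ h0
  have h99 := hasMaj_qvRe_pull_sub_comp_of_line M kk r (B := 2 * Real.exp (ρ₀ / 2) / ((L ^ kk : ℕ) : ℝ) * 1) (by positivity) hline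
  rw [LinearMap.comp_id] at h99
  have hc := hasMaj_tensorId ι (fun y y' => by positivity) h99
  rw [tensorId_sub, ← tensorId_comp_tensorId, tensorId_pull] at hc
  -- piece 1: `Q′∘(T′∘(Q′* − PQ*))`
  have h1a := hasMaj_comp_exp (ρ := ρ₀ / 2) (σ := ρ₀ / 2) htri hd hrow₂ hA0 (by positivity) hσ₂.le (by linarith) (by linarith) hT'₀ hb
  have h1 := hasMaj_comp_exp (ρ := ρ₀ / 4) (σ := ρ₀ / 4) htri hd hrow₄ (by positivity)
    (mul_nonneg (mul_nonneg (mul_nonneg (BlockNorm.κ_nonneg _) hA0) (by positivity)) hc₂0.le) hσ₄.le (by linarith) (by linarith) hQf h1a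
  -- piece 2: `Q′∘(𝔇(T′,T)∘Q*)`
  have h2a := hasMaj_comp_exp (ρ := ρ₀ / 2) (σ := ρ₀ / 2) htri hd hrow₂ hB0 (by positivity) hσ₂.le (by linarith) (by linarith) hD₀ hAc
  have h2 := hasMaj_comp_exp (ρ := ρ₀ / 4) (σ := ρ₀ / 4) htri hd hrow₄ (by positivity)
    (mul_nonneg (mul_nonneg (mul_nonneg (BlockNorm.κ_nonneg _) hB0) (by positivity)) hc₂0.le) hσ₄.le (by linarith) (by linarith) hQf h2a
  -- piece 3: `(Q′P − Q)∘(T∘Q*)`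
  have h3a := hasMaj_comp_exp (ρ := ρ₀ / 2) (σ := ρ₀ / 2) htri hd hrow₂ hA0 (by positivity) hσ₂.le (by linarith) (by linarith) hT₀ hAc
  have h3 := hasMaj_comp_exp (ρ := ρ₀ / 4) (σ := ρ₀ / 4) htri hd hrow₄ (by positivity)
    (mul_nonneg (mul_nonneg (mul_nonneg (BlockNorm.κ_nonneg _) hA0) (by positivity)) hc₂0.le) hσ₄.le (by linarith) (by linarith) hc h3a
  have hsum := h1.add (h2.add h3)
  -- read the block majorant of the telescoped difference as a coloured entry letter
  intro p q
  rw [← Matrix.sub_apply, ← unitBondMatC_sub, sandwich_telescope _ _ _ _ _ _ (pull (liftMap (kingPrV L kk r M) ι))]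
  have hKtot : 0 ≤ c₂ * c₄ * Real.exp (ρ₀ / 2) * Real.exp ρ₀ * (4 * K₁ + K₂) * ((((L ^ kk : ℕ) : ℝ)) ^ (-(1 / 16 : ℝ)) + basisConst e * rA * ((((L ^ kk : ℕ) : ℝ))⁻¹)) := by
    positivity
  refine abs_unitBondMatC_le_of_hasMaj M kk ι (δ := ρ₀ / 4) hKtot (hsum.mono fun y y' => ?_) p q
  have hcast : ((L : ℝ) ^ kk) = (((L ^ kk : ℕ) : ℝ)) := by push_cast; rfl
  simp only [kappa_ofBlocks, hcast]
  refine three_mul_le (Real.exp_nonneg _) ?_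
  -- the three amplitudes against `K·(θ + κ_e r_A η)`: the slack is `4K₁θ ≥ 0`
  have hθK : 0 ≤ K₁ * (((L ^ kk : ℕ) : ℝ)) ^ (-(1 / 16 : ℝ)) := mul_nonneg hK₁.le hθ0
  have hcc : 0 ≤ c₂ * c₄ * Real.exp (ρ₀ / 2) * Real.exp ρ₀ := by positivity
  have hslack := mul_nonneg hcc hθK
  rw [div_eq_mul_inv (2 * Real.exp ρ₀) (((L ^ kk : ℕ) : ℝ)), div_eq_mul_inv (2 * Real.exp (ρ₀ / 2)) (((L ^ kk : ℕ) : ℝ))]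
  linarith [hslack]

end Rate

/-! ## §3 The three letters of the live background matrix with common constants — the complete input of Σ-col (H) -/

section Letters

variable {L : ℕ} [NeZero L]

/-- ★★★ **THE THREE LETTERS OF THE LIVE BACKGROUND MATRIX, ONE SET OF CONSTANTS**: `∃ δ w₀ R₀ K > 0` (from `d, L, a, ι`) such that in FILE 133's regime, on the coloured unit bonds
of the cover, (i) `|Z(A)_{pq}| ≤ K·κ_e·r_A·e^{−δ·cdist}`, (ii) `|Z′(A)_{pq}| ≤ K·κ_e·r_A·e^{−δ·cdist}`, (iii) `|Z′(A)_{pq} − Z(A)_{pq}| ≤ K·((L^k)^{−1/16} + κ_e·r_A·L^{−k})·e^{−δ·cdist}` —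
FILE (J-a) `exists_abs_zc_le` and §2 `exists_abs_zc_sub_le` at the smaller rate and the larger constant: exactly the hypotheses `hZ`, `hZ'`, `hZZ` of Σ-col (H) `exDress_deltaCol_letters`
with `ζ = K·κ_e·r_A`, `τ = K·((L^k)^{−1/16} + κ_e·r_A·L^{−k})`. [cite: Balaban1984PropagatorsI, (1.102)–(1.103) p.34; Balaban1984PropagatorsII, (2.52)–(2.56) pp.232–233; Balaban1985BackgroundPropagators, Thm 3.1 (3.42) p.397 (shape), (3.62)–(3.65) pp.402–403] -/
theorem exists_zc_letters (hL : Odd L ∧ 1 < L) (hL7 : 7 ≤ L) {a : ℝ} (ha : 0 < a) (ι : Type) [Fintype ι] [DecidableEq ι] [Nonempty ι] :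
    ∃ δ w₀ R₀ K : ℝ, 0 < δ ∧ 0 < R₀ ∧ 0 < K ∧
      ∀ (mv kk r : ℕ), 1 ≤ kk → w₀ ≤ ((L ^ mv : ℕ) : ℝ) →
      ∀ {mm : Type} [Fintype mm] [DecidableEq mm] (e : Matrix mm mm ℂ ≃L[ℝ] (ι → ℝ)), (∀ A B : Matrix mm mm ℂ, traceForm A B = e A ⬝ᵥ e B) →
      ∀ (A' : Fin (d + 1) → CvX' d L mv kk r hL → Matrix mm mm ℂ), (∀ μ x', (A' μ x')ᴴ = -A' μ x') →
      ∀ (rA : ℝ), 0 ≤ rA → (∀ μ x', ‖A' μ x'‖ ≤ rA) →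
        (∀ μ κ x', ‖A' μ (bshiftEquiv (cvM d L mv kk hL) (L ^ r * L ^ kk) κ x') - A' μ x'‖ ≤ rA * ((((L ^ r * L ^ kk : ℕ) : ℝ))⁻¹)) →
        (∀ μ κ x', ‖(A' μ (bshiftEquiv (cvM d L mv kk hL) (L ^ r * L ^ kk) κ x') - A' μ x') -
            (A' μ (bshiftEquiv (cvM d L mv kk hL) (L ^ r * L ^ kk) κ ((bshiftEquiv (cvM d L mv kk hL) (L ^ r * L ^ kk) μ).symm x')) -
              A' μ ((bshiftEquiv (cvM d L mv kk hL) (L ^ r * L ^ kk) μ).symm x'))‖ ≤ rA * ((((L ^ r * L ^ kk : ℕ) : ℝ))⁻¹) * ((((L ^ r * L ^ kk : ℕ) : ℝ))⁻¹)) →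
        2 * ((1 + Fintype.card (Fin (d + 1))) * ((3 + 2 * ((d : ℝ) + 1)) * rA)) ≤ 1 →
        (14 * Real.exp 1 * (1 + Fintype.card (Fin (d + 1))) * basisConst e * ((1 + Fintype.card (Fin (d + 1))) * ((3 + 2 * ((d : ℝ) + 1)) * rA))) * (1 + Fintype.card (Fin (d + 1) ⊕ Fin (d + 1))) ≤ R₀ →
        (∀ p q, |unitBondMatC (cvM d L mv kk hL) ι
            (tensorId ι (qvRe (cvM d L mv kk hL) (L ^ kk)) ∘ₗ
              (cvGlued d L mv kk hL a ((((L ^ kk : ℕ) : ℝ))⁻¹) ι e (fun _ _ => (1 : Matrix mm mm ℂ))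
                  (fun μ x => NormedSpace.exp (((((L ^ kk : ℕ) : ℝ))⁻¹) • gavgM (Matrix mm mm ℂ) (Fin (d + 1)) (kingPrV L kk r (cvM d L mv kk hL)) A' μ x)) (cvNL d L mv kk hL a ι) (fun _ => 0) -
                tensorId ι (gOp (cvM d L mv kk hL) (L ^ kk) a)) ∘ₗ
              tensorId ι (qvAdjRe (cvM d L mv kk hL) (L ^ kk))) p q| ≤ K * basisConst e * rA * Real.exp (-(δ * cdist (cvM d L mv kk hL) ι p q))) ∧
        (∀ p q, |unitBondMatC (cvM d L mv kk hL) ι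
            (tensorId ι (qvRe (cvM d L mv kk hL) (L ^ r * L ^ kk)) ∘ₗ
              (cvGlued' d L mv kk r hL a ((((L ^ r * L ^ kk : ℕ) : ℝ))⁻¹) ι e (fun _ _ => (1 : Matrix mm mm ℂ)) (fun μ x' => NormedSpace.exp (((((L ^ r * L ^ kk : ℕ) : ℝ))⁻¹) • A' μ x'))
                  (cvNL' d L mv kk r hL a ι) (fun _ => 0) -
                tensorId ι (gOp (cvM d L mv kk hL) (L ^ r * L ^ kk) a)) ∘ₗ
              tensorId ι (qvAdjRe (cvM d L mv kk hL) (L ^ r * L ^ kk))) p q| ≤ K * basisConst e * rA * Real.exp (-(δ * cdist (cvM d L mv kk hL) ι p q))) ∧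
        (∀ p q, |unitBondMatC (cvM d L mv kk hL) ι
            (tensorId ι (qvRe (cvM d L mv kk hL) (L ^ r * L ^ kk)) ∘ₗ
              (cvGlued' d L mv kk r hL a ((((L ^ r * L ^ kk : ℕ) : ℝ))⁻¹) ι e (fun _ _ => (1 : Matrix mm mm ℂ)) (fun μ x' => NormedSpace.exp (((((L ^ r * L ^ kk : ℕ) : ℝ))⁻¹) • A' μ x'))
                  (cvNL' d L mv kk r hL a ι) (fun _ => 0) -
                tensorId ι (gOp (cvM d L mv kk hL) (L ^ r * L ^ kk) a)) ∘ₗ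
              tensorId ι (qvAdjRe (cvM d L mv kk hL) (L ^ r * L ^ kk))) p q -
          unitBondMatC (cvM d L mv kk hL) ι
            (tensorId ι (qvRe (cvM d L mv kk hL) (L ^ kk)) ∘ₗ
              (cvGlued d L mv kk hL a ((((L ^ kk : ℕ) : ℝ))⁻¹) ι e (fun _ _ => (1 : Matrix mm mm ℂ))
                  (fun μ x => NormedSpace.exp (((((L ^ kk : ℕ) : ℝ))⁻¹) • gavgM (Matrix mm mm ℂ) (Fin (d + 1)) (kingPrV L kk r (cvM d L mv kk hL)) A' μ x)) (cvNL d L mv kk hL a ι) (fun _ => 0) -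
                tensorId ι (gOp (cvM d L mv kk hL) (L ^ kk) a)) ∘ₗ
              tensorId ι (qvAdjRe (cvM d L mv kk hL) (L ^ kk))) p q|
          ≤ K * ((((L ^ kk : ℕ) : ℝ)) ^ (-(1 / 16 : ℝ)) + basisConst e * rA * ((((L ^ kk : ℕ) : ℝ))⁻¹)) * Real.exp (-(δ * cdist (cvM d L mv kk hL) ι p q))) := by
  have hLpos : 0 < L := Nat.pos_of_ne_zero (NeZero.ne L)
  obtain ⟨δa, wa, Ra, Ka, hδa, hRa, hKa, Ha⟩ := exists_abs_zc_le (d := d) hL hL7 ha ι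
  obtain ⟨δb, wb, Rb, Kb, hδb, hRb, hKb, Hb⟩ := exists_abs_zc_sub_le (d := d) hL hL7 ha ι
  refine ⟨min δa δb, max wa wb, min Ra Rb, max Ka Kb, lt_min hδa hδb, lt_min hRa hRb, lt_max_of_lt_left hKa, fun mv kk r hk hw₀ => ?_⟩
  intro mm _ _ e he A' hA' rA hrA h1 h2 h3 hr2 hRle
  obtain ⟨hZ, hZ'⟩ := Ha mv kk r hk ((le_max_left _ _).trans hw₀) e he A' hA' rA hrA h1 h2 h3 hr2 (hRle.trans (min_le_left _ _))
  have hZZ := Hb mv kk r hk ((le_max_right _ _).trans hw₀) e he A' hA' rA hrA h1 h2 h3 hr2 (hRle.trans (min_le_right _ _))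
  set M := cvM d L mv kk hL with hM
  have hκ0 : 0 ≤ basisConst e := basisConst_nonneg e
  have hkpos : (0 : ℝ) < ((L ^ kk : ℕ) : ℝ) := Nat.cast_pos.mpr (pow_pos hLpos kk)
  have hθ0 : 0 ≤ (((L ^ kk : ℕ) : ℝ)) ^ (-(1 / 16 : ℝ)) := Real.rpow_nonneg hkpos.le _
  have hη0 : 0 ≤ ((((L ^ kk : ℕ) : ℝ))⁻¹) := inv_nonneg.mpr hkpos.le
  have hA0 : 0 ≤ Ka * basisConst e * rA := by positivity
  have hB0 : 0 ≤ Kb * ((((L ^ kk : ℕ) : ℝ)) ^ (-(1 / 16 : ℝ)) + basisConst e * rA * ((((L ^ kk : ℕ) : ℝ))⁻¹)) := by positivity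
  have hKA : Ka * basisConst e * rA ≤ max Ka Kb * basisConst e * rA :=
    mul_le_mul_of_nonneg_right (mul_le_mul_of_nonneg_right (le_max_left _ _) hκ0) hrA
  have hKB : Kb * ((((L ^ kk : ℕ) : ℝ)) ^ (-(1 / 16 : ℝ)) + basisConst e * rA * ((((L ^ kk : ℕ) : ℝ))⁻¹)) ≤
      max Ka Kb * ((((L ^ kk : ℕ) : ℝ)) ^ (-(1 / 16 : ℝ)) + basisConst e * rA * ((((L ^ kk : ℕ) : ℝ))⁻¹)) :=
    mul_le_mul_of_nonneg_right (le_max_right _ _) (by positivity)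
  refine ⟨fun p q => (hZ p q).trans ?_, fun p q => (hZ' p q).trans ?_, fun p q => (hZZ p q).trans ?_⟩
  · exact (exp_decay_mono hA0 (min_le_left δa δb) (cdist_nonneg M ι p q)).trans (mul_le_mul_of_nonneg_right hKA (Real.exp_nonneg _))
  · exact (exp_decay_mono hA0 (min_le_left δa δb) (cdist_nonneg M ι p q)).trans (mul_le_mul_of_nonneg_right hKA (Real.exp_nonneg _))
  · exact (exp_decay_mono hB0 (min_le_right δa δb) (cdist_nonneg M ι p q)).trans (mul_le_mul_of_nonneg_right hKB (Real.exp_nonneg _))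

end Letters

end Summit.QuantumFields.YangMills.BalabanUVNodes.N15.GluedZeroField
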